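import Literature.AlgebraicGeometry.Motives.RatFnBirational
import Literature.AlgebraicGeometry.Resolution.BlowupRegularPoints
import Literature.AlgebraicGeometry.Resolution.BlowupSequences
import Literature.AlgebraicGeometry.Resolution.BlowupStalkCharts
import Literature.AlgebraicGeometry.Resolution.HilbertSamuelIsolatedSingularities
import Summits.ResolutionOfSingularities.ResolutionOfSingularities.Theorems.RadicialJungCleanModelsStubNodalBlowupChart
import Summits.ResolutionOfSingularities.ResolutionOfSingularities.Theorems.RadicialJungCleanModelsReduction
import HarnessLib

/-!
# Stub `stub_nodalBlowup`, part 3/3: nodal points are cured by one point blow-up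
(crux stmt-ResolutionOfSingularities-15917, `CleanModels`, line `Sketch` rev 7)

Route `ResolutionOfSingularities/RadicialJung`, crux item `CleanModels`, line `Sketch` (rev 7), the
dimension-2 Zariski descent: **nodal points are cured by one point blow-up** (`stub_nodalBlowup`).

Let `V` be a regular integral separated scheme of finite type over a field `k` of
characteristic `p`, `S ⊆ V` a finite set of closed points and, for `v ∈ S`, `xs v ∈ K(V)` of
NODAL TYPE at `v`: `xs v = u f₁^e` with `u` a unit, `p ∤ e`, `f₁ ≡ c t₁ t₂ (mod 𝔪_v³)` for a
regular system of parameters `(t₁, t₂)` of the two-dimensional `𝒪_{V,v}` and a unit `c`. Let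
`ρ : V' = Bl_S V → V` be the blowing up of `S` with its reduced structure (tree `blowup`,
`BlowupSequences.lean`). Then `ρ` is proper (`IsBlowup.isProper`) and birational
(`IsBlowup.isBirational'`), `V'` is integral (`IsBlowup.isIntegral`) and regular (over `S` by
`IsBlowup.isRegularLocalRing_stalk_of_finite`, Liu 8.1.19 (a); off `S` the stalks are those of
`V`, `IsBlowup.isOpenImmersion_preimage_compl_ι`), `ρ` is an isomorphism over `V ∖ S`
(`IsBlowup.isIso_morphismRestrict`), and at every point `v'` over `v ∈ S` the twist
`h^p · xs v`, `h = t_i^{-⌊2e/p⌋}`, is LOOSELY CLEAN in `𝒪_{V',v'}`: the stalk of the ideal of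
`S` at `v` is `𝔪_v = (t₁, t₂)` (`stalkIdeal_vanishingIdeal_of_finite`), `𝒪_{V',v'}` is the
localization of a Rees chart `𝒪_v[t_j/t_i]` at a prime over `𝔪_v`
(`IsBlowup.exists_reesChart_stalk`, with `χ ∘ chartBase = ρ^♯_{v'}`), the chart computation is
`chart_loose` (part 2/3), and the twist is transported along the square
"stalk → function field" (`RatFn.functionFieldMap_toFunctionField`, `loose_transport`, part
1/3). (`𝓘_S ≠ 0` because the generic stalk is a field, of dimension `0 ≠ 2`.)
-/

noncomputable section

set_option linter.dupNamespace false -- mandated namespace of this single-conjunct summit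

open CategoryTheory AlgebraicGeometry TopologicalSpace IsLocalRing
open Literature.AlgebraicGeometry.Resolution Literature.AlgebraicGeometry.Motives

namespace Summit.ResolutionOfSingularities.ResolutionOfSingularities.Theorems.RadicialJung.CleanModels

universe u

section Blowup

/-- STUB `stub_nodalBlowup` (worker; dim-2 descent, the blow-up) — **nodal points are cured by one
point blow-up.** Let `V` be a regular integral separated scheme of finite type over a field `k`
of characteristic `p`, `S` a finite set of closed points, and for each `v ∈ S` a rational
function `xs v` of NODAL TYPE at `v` (`xs v = u f^e`, `u` unit, `p ∤ e`,
`f ≡ c t₁ t₂ (mod 𝔪_v³)`, `(t₁, t₂)` a regular system of parameters, `dim O_{V,v} = 2`). Then the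
blowing up `ρ : V' → V` of `S` (reduced) is proper and birational, an isomorphism over `V ∖ S`,
`V'` is integral and regular, and at every closed point `v'` over `v ∈ S` some `p`-th-power
twist `h^p · xs v` (`h = t_i^{-⌊2e/p⌋} ≠ 0`) is loosely clean in `𝒪_{V',v'}` (toroidal along a
regular system of parameters with exponents prime to `p`, or a unit residually not a `p`-th
power, or `c'^p +` a regular parameter). -/
theorem stub_nodalBlowup (p : ℕ) (hp : p.Prime) (k : Type) [Field k] [CharP k p]
    (V : Scheme.{0}) [IsIntegral V] (f : V ⟶ Spec (.of k)) [IsSeparated f] [LocallyOfFiniteType f]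
    [QuasiCompact f] (hVreg : Scheme.IsRegular V) (S : Set V) (hSfin : S.Finite)
    (hScl : ∀ v ∈ S, IsClosed ({v} : Set V)) (xs : V → V.functionField)
    (hnodal : ∀ v ∈ S,
      (∃ (u f₁ c t₁ t₂ : V.presheaf.stalk v) (e : ℕ), IsUnit u ∧ IsUnit c ∧ ¬ p ∣ e ∧
          Ideal.span {t₁, t₂} = maximalIdeal (V.presheaf.stalk v) ∧ ringKrullDim (V.presheaf.stalk v) = (2 : WithBot ℕ∞) ∧
          xs v = algebraMap (V.presheaf.stalk v) V.functionField (u * f₁ ^ e) ∧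
          f₁ - c * t₁ * t₂ ∈ maximalIdeal (V.presheaf.stalk v) ^ 3)) :
    ∃ (V' : Scheme.{0}) (ρ : V' ⟶ V) (_ : IsIntegral V') (_ : IsDominant ρ),
      IsProper ρ ∧ IsBirational ρ ∧ Scheme.IsRegular V' ∧
      (∃ U : V.Opens, (U : Set V) = Sᶜ ∧ IsIso (ρ ∣_ U)) ∧
      ∀ v' : V', IsClosed ({v'} : Set V') → ρ.base v' ∈ S → ∃ h : V.functionField, h ≠ 0 ∧
        ((∃ (d m : ℕ) (hmd : m ≤ d) (t : Fin d → V'.presheaf.stalk v') (a : Fin m → ℕ)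
            (u : V'.presheaf.stalk v'), IsUnit u ∧
            Ideal.span (Set.range t) = maximalIdeal (V'.presheaf.stalk v') ∧
            ringKrullDim (V'.presheaf.stalk v') = (d : WithBot ℕ∞) ∧ 0 < m ∧ (∀ i, ¬ p ∣ a i) ∧
            RatFn.functionFieldMap ρ (h ^ p * xs (ρ.base v')) =
              algebraMap (V'.presheaf.stalk v') V'.functionField (u * ∏ i : Fin m, t (Fin.castLE hmd i) ^ (a i))) ∨
          (∃ u : V'.presheaf.stalk v', IsUnit u ∧ RatFn.functionFieldMap ρ (h ^ p * xs (ρ.base v')) = algebraMap (V'.presheaf.stalk v') V'.functionField u ∧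
            ∀ c' : V'.presheaf.stalk v', u - c' ^ p ∉ maximalIdeal (V'.presheaf.stalk v')) ∨
          (∃ s c' : V'.presheaf.stalk v', RatFn.functionFieldMap ρ (h ^ p * xs (ρ.base v')) = algebraMap (V'.presheaf.stalk v') V'.functionField s ∧
            s - c' ^ p ∈ maximalIdeal (V'.presheaf.stalk v') ∧ s - c' ^ p ∉ maximalIdeal (V'.presheaf.stalk v') ^ 2)) := by
  classical
  haveI : IsLocallyNoetherian V := LocallyOfFiniteType.isLocallyNoetherian f
  -- the centre: `S` with its reduced structure
  have hS : IsClosed S := isClosed_of_finite_of_isClosed_singleton hSfin hScl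
  set J : V.IdealSheafData := Scheme.IdealSheafData.vanishingIdeal ⟨S, hS⟩ with hJdef
  have hsupp : (J.support : Set V) = S :=
    Scheme.IdealSheafData.coe_support_vanishingIdeal ⟨S, hS⟩
  have hJ : J ≠ ⊥ := by
    intro hJ0
    have huniv : S = Set.univ := by
      rw [← hsupp, hJ0, Scheme.IdealSheafData.support_bot]
      rfl
    obtain ⟨-, -, -, -, -, -, -, -, -, -, hdim2, -⟩ :=
      hnodal (genericPoint V) (huniv ▸ Set.mem_univ _)
    have h0 : ringKrullDim (V.presheaf.stalk (genericPoint V)) = 0 :=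
      ringKrullDim_eq_zero_of_field V.functionField
    have : (0 : WithBot ℕ∞) = 2 := h0.symm.trans hdim2
    exact absurd this (by norm_num)
  have hρ := blowup.isBlowup J
  haveI : IsIntegral (blowup J) := hρ.isIntegral hJ
  have hbir : IsBirational (blowup.π J) := hρ.isBirational' hJ
  haveI : IsDominant (blowup.π J) := hbir.isDominant
  haveI : IsProper (blowup.π J) := hρ.isProper
  -- the blow-up is regular
  have hRo : IsOpen (Scheme.regularLocus V) := by
    rw [hVreg.regularLocus_eq_univ]
    exact isOpen_univ
  have hreg' : Scheme.IsRegular (blowup J) := by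
    intro v'
    by_cases hv : (blowup.π J).base v' ∈ S
    · exact hρ.isRegularLocalRing_stalk_of_finite hRo hS hSfin hScl (fun v _ => hVreg v) hv
    · obtain ⟨U, hU⟩ : ∃ U : (blowup J).Opens, U = blowup.π J ⁻¹ᵁ centreCompl J := ⟨_, rfl⟩
      have hx' : v' ∈ U := by
        rw [hU]
        change (blowup.π J).base v' ∈ ((J.support : Set V))ᶜ
        rw [hsupp]
        exact hv
      haveI hoi : IsOpenImmersion (U.ι ≫ blowup.π J) := by
        rw [hU]
        exact hρ.isOpenImmersion_preimage_compl_ι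
      have h2 : IsIso ((blowup.π J).stalkMap v' ≫ U.ι.stalkMap ⟨v', hx'⟩) := by
        have h3 : IsIso ((U.ι ≫ blowup.π J).stalkMap ⟨v', hx'⟩) := inferInstance
        rw [Scheme.Hom.stalkMap_comp] at h3
        exact h3
      have h4 : IsIso (U.ι.stalkMap ⟨v', hx'⟩) := inferInstance
      haveI : IsIso ((blowup.π J).stalkMap v') :=
        @IsIso.of_isIso_comp_right _ _ _ _ _ ((blowup.π J).stalkMap v')
          (U.ι.stalkMap ⟨v', hx'⟩) h4 h2
      haveI := hVreg ((blowup.π J).base v')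
      exact IsRegularLocalRing.of_ringEquiv
        (asIso ((blowup.π J).stalkMap v')).commRingCatIsoToRingEquiv
  -- an isomorphism over `V ∖ S`
  have hUiso : IsIso (blowup.π J ∣_ ⟨Sᶜ, hS.isOpen_compl⟩) :=
    hρ.isIso_morphismRestrict (by
      change Disjoint Sᶜ (J.support : Set V)
      rw [hsupp]
      exact disjoint_compl_left)
  refine ⟨blowup J, blowup.π J, inferInstance, inferInstance, inferInstance, hbir, hreg',
    ⟨⟨Sᶜ, hS.isOpen_compl⟩, rfl, hUiso⟩, ?_⟩
  intro v' _ hv'S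
  -- the nodal data at `v = ρ v'`
  obtain ⟨u, f₁, cc, t₁, t₂, e, hu, hcc, he, hspan, hdim2, hxs, hf⟩ := hnodal _ hv'S
  haveI : IsRegularLocalRing (V.presheaf.stalk ((blowup.π J).base v')) := hVreg _
  haveI : CharP (V.presheaf.stalk ((blowup.π J).base v')) p := charP_stalk V f _
  obtain ⟨c, hcdef⟩ : ∃ c : Fin 2 → V.presheaf.stalk ((blowup.π J).base v'), c = ![t₁, t₂] :=
    ⟨_, rfl⟩
  have hc0 : c 0 = t₁ := by rw [hcdef]; rfl
  have hc1 : c 1 = t₂ := by rw [hcdef]; rfl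
  have hc : Ideal.span (Set.range c) = maximalIdeal _ := by
    rw [hcdef, Matrix.range_cons_cons_empty]
    exact hspan
  obtain ⟨hz, hd⟩ := rsop_pair_aux c hc hdim2
  -- the stalk of `J` at `v` is `𝔪_v = (t₁, t₂)`; the chart through `v'`
  have hst : stalkIdeal J ((blowup.π J).base v') = maximalIdeal _ :=
    stalkIdeal_vanishingIdeal_of_finite (Z := ⟨S, hS⟩) hSfin hScl hv'S
  obtain ⟨jc, 𝔴, χ, hχ, hloc, h𝔴⟩ := hρ.exists_reesChart_stalk v' c (hc.trans hst.symm)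
  letI := χ.toAlgebra
  haveI : IsLocalization.AtPrime ((blowup J).presheaf.stalk v') 𝔴.asIdeal := hloc
  haveI : IsNoetherianRing (chartRing c jc) := isNoetherianRing_blowupChart c jc
  obtain ⟨jo, hjo, hprod⟩ := fin_two_other jc
  have hf' : f₁ - cc * c jc * c jo ∈ maximalIdeal _ ^ 3 := by
    rw [mul_assoc, hprod _ c, hc0, hc1, ← mul_assoc]
    exact hf
  obtain ⟨ft, y, hft, hy, hloose⟩ := chart_loose c jc ((blowup J).presheaf.stalk v')
    (chartBase c jc) (chartGen c jc)
    (reesChartBase_mem_nonZeroDivisors (c jc) (Ideal.mem_span_range_self (f := c) (x := jc)))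
    (chartQuotEquiv c jc (isQuasiRegular_centre c Fin.elim0 hz hd)) (chartQuotMap_C c jc)
    (chartQuotMap_X c jc) 𝔴.asIdeal h𝔴 p hp hc hdim2 jo hjo
    (reesChartBase_apply_eq_mul_chartGen c jc jo) u f₁ cc e hu hcc he hf'
  -- transport to the function fields
  have hcjne : c jc ≠ 0 := (isRsopPart_centre c Fin.elim0 hz hd).ne_zero jc
  have hι : algebraMap _ V.functionField (c jc) ≠ 0 :=
    (map_ne_zero_iff _ (IsFractionRing.injective _ _)).mpr hcjne
  exact loose_transport (K := V.functionField) (K' := (blowup J).functionField)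
    (chartBase c jc)
    (algebraMap (chartRing c jc) ((blowup J).presheaf.stalk v') :
      chartRing c jc →+* (blowup J).presheaf.stalk v')
    (RatFn.functionFieldMap (blowup.π J))
    (fun a => (RatFn.functionFieldMap_toFunctionField (blowup.π J) v' a).trans
      (congrArg (algebraMap ((blowup J).presheaf.stalk v') (blowup J).functionField) (hχ a).symm))
    p e u f₁ (c jc) ft y (xs _) hxs hft hy hι hloose

end Blowup

end Summit.ResolutionOfSingularities.ResolutionOfSingularities.Theorems.RadicialJung.CleanModels

end
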